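import Summits.QuantumFields.BalabanUV.Beta.FP.RoadEnd
import Summits.QuantumFields.BalabanUV.Beta.FP.PerfectObjects

/-!
# `BalabanUV.Beta.FP.PerfectObjectsT` — road «FP» for binder row D1, leaf N0a-T (THE TYPER): the PERFECT (fixed-point) OBJECTS as the constructed
# entrywise limits (asym1's `limMKerOf/limStOf/limTabOf`) of the unit-rescaled (j, m)-families; the perfect polarization `TPerfOf` and its (1.22)-type
# coefficient `fPerf`; the member `m = 1` IS road A2's limit triple BY `rfl`; and road FP's END RE-POSED OVER THE PERFECT FAMILY: the STEP LAW and the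
# LEADING-LOG ASYMPTOTICS are now hypotheses about the ONE named sequence `m ↦ fPerf … m`

HONEST FRAMING (cell contract, verbatim): «discharging `BetaPertH` makes Bałaban's UV stability UNCONDITIONAL — a real constructive-QFT result;
it is NOT the continuum limit and NOT the Clay problem.»  THIS MODULE DISCHARGES NOTHING: definitions by abbreviation over landed constructors +
the END of `FP/RoadEnd` with `g := fPerf …` substituted.  Every analytic statement ((CONV-C-Cauchy) = row G-an2-4; the step law = leaf N2/N6; the
asymptotics = leaf N7; convergence of the (j, m)-families for m ≥ 2 = X1m) stays a HYPOTHESIS.  Skeleton `HOME/beta/skeletons/D1-b2b-balaban-beta-d1-p3.md`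
§2–§3; claim table `HOME/b2b-balaban-beta-d1-p3/LEAVES-FP.md` (row N0a-T).  NOT BetaPertH, NOT continuum, NOT Clay.
ABSOLUTE RULE (cell, verbatim): «No internally-minted statement may enter as a cited fact. Every hypothesis is either kernel-proved in this package or a
verbatim quotation of a PUBLISHED theorem with page reference.»  Nothing is cited; no `def … : Prop`; no binder instantiated at a value.

READING (header clause only, never a hypothesis).  `KPerf Lc sf sm m` = the packed resolvent of the Gaussian fixed point's `m`-fold step (blocking `Lc^m`)
in the units `(sf, sm)` in which the suppliers' convergence is uniform; `SPerfOf`/`WPerfOf` = the perfect first- and second-order jets, as limits of ANY supplied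
(j, m)-indexed jet families `S j m`, `Wt j m` whose `m = 1` members are the wall family's `(JsBal0Of … j).S`, `W j`; `TPerfOf n K S W` = the one-loop vacuum
polarization of ONE perfect step with blocking `n` (leaf N1: for `n = Lc^m` this IS the `m`-fold composite); `fPerf … m` = its (1.22) second moment.

CONTENT.  §1 defs `KPerf`, `SPerfOf`, `WPerfOf`, `TPerfOf`, `fPerf` + `KPerf_one` (`m = 1` is road A2's `limMKerOf (j ↦ unitK (KInvStep Lc j))`, by `KInvStep_eq_KTot`),
`SPerfOf_one`/`WPerfOf_one` (under `hS1 : ∀ j, S j 1 = (JsBal0Of … j).S`, `hW1 : ∀ j, Wt j 1 = W j`), `fPerf_one` (`fPerf … 1` = the second moment of road A2's limit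
kernel `T∞`).  §2 **`d1Drift_JsBalOf_of_perfect_step_law_bounded`** / **`_littleO`**: asym1's nine limit-currency binders AT THE PERFECT TRIPLE + (STEP)
`fPerf (m+1) = fPerf m + fPerf 1` + (ASYMP) `|fPerf m − m·stepBal N Lc| ≤ C` (or `/m → 0`) ⊢ `D1Drift Lc (JsBalOf …) N μ ν` (`FP/RoadEnd` with `g := fPerf`, `hg1 := fPerf_one`).
-/

namespace Summit.QuantumFields.BalabanUV.Beta.FP.PerfectObjectsT

open Filter Topology
open Literature.MathematicalPhysics.QuantumFieldTheory.Balaban1983to89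
open Literature.MathematicalPhysics.QuantumFieldTheory.Balaban1983to89.Beta
open ExpKernelCalculus (MKer Decays VertexFamily₂ hessKer)
open OneStepResolventKernel (Fib LocStencil)
open OneStepKernelFamily (KInvStep D1Drift)
open AxialDressing (axDressK axVertexOfK)
open BalabanStepJetsSucc (JsBal0Of JsBalOf)
open B12Normalization (stepBal)
open HessKerDressedLimit (limMKerOf limStOf limTabOf)
open Summit.QuantumFields.BalabanUV.Beta.HessKerDressedUnits (unitK unitS unitW)
open Summit.QuantumFields.BalabanUV.Beta.FP.PerfectObjects (KTot KInvStep_eq_KTot)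
open Summit.QuantumFields.BalabanUV.Beta.FP.RoadEnd (d1Drift_JsBalOf_of_rate_step_law_bounded d1Drift_JsBalOf_of_rate_step_law_littleO)

/-! ## §1 The perfect objects -/

section Objects

variable {d : ℕ}

/-- [our object] **THE PERFECT RESOLVENT OF THE `m`-FOLD STEP** in units `(sf, sm)`: the constructed entrywise limit, as `j → ∞`, of the unit-rescaled
(j, m)-resolvents `KTot (Lc^(j+m)) (Lc^j)`. -/
noncomputable def KPerf (Lc : ℕ) [NeZero Lc] (sf sm : ℕ → ℝ) (m : ℕ) : MKer (d + 1) (Fib d) :=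
  limMKerOf fun j => unitK (sf j) (sm j) (KTot (d := d) (Lc ^ (j + m)) (Lc ^ j))

/-- [our object] `m = 1`: the perfect one-step resolvent IS road A2's constructed limit `limMKerOf (j ↦ unitK (KInvStep Lc j))` — by `rfl`
(`FP.PerfectObjects.KInvStep_eq_KTot`). -/
theorem KPerf_one (Lc : ℕ) [NeZero Lc] (sf sm : ℕ → ℝ) :
    KPerf (d := d) Lc sf sm 1 = limMKerOf fun j => unitK (sf j) (sm j) (KInvStep (d := d) Lc j) := rfl

/-- [our object] **THE PERFECT FIRST-ORDER JETS**: the constructed limit of ANY supplied (j, m)-indexed stencil families, unit-rescaled. -/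
noncomputable def SPerfOf (sf sm : ℕ → ℝ) (S : ℕ → ℕ → Fin (d + 1) → (Fin (d + 1) → ℤ) → MKer (d + 1) (Fib d)) (m : ℕ) :
    Fin (d + 1) → (Fin (d + 1) → ℤ) → MKer (d + 1) (Fib d) :=
  limStOf fun j => unitS (sf j) (sm j) (S j m)

/-- [our object] **THE PERFECT SECOND-ORDER TABLES**: the constructed limit of ANY supplied (j, m)-indexed table families, unit-rescaled. -/
noncomputable def WPerfOf (sf sm : ℕ → ℝ)
    (Wt : ℕ → ℕ → Fin (d + 1) → (Fin (d + 1) → ℤ) → Fin (d + 1) → (Fin (d + 1) → ℤ) → MKer (d + 1) (Fib d)) (m : ℕ) :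
    Fin (d + 1) → (Fin (d + 1) → ℤ) → Fin (d + 1) → (Fin (d + 1) → ℤ) → MKer (d + 1) (Fib d) :=
  limTabOf fun j => unitW (sf j) (sm j) (Wt j m)

/-- [our object] `m = 1` with the wall family's stencils: `SPerfOf … 1` is road A2's `Sinf`. -/
theorem SPerfOf_one (sf sm : ℕ → ℝ)
    {S : ℕ → ℕ → Fin (d + 1) → (Fin (d + 1) → ℤ) → MKer (d + 1) (Fib d)} {S1 : ℕ → Fin (d + 1) → (Fin (d + 1) → ℤ) → MKer (d + 1) (Fib d)}
    (hS1 : ∀ j, S j 1 = S1 j) : SPerfOf sf sm S 1 = limStOf fun j => unitS (sf j) (sm j) (S1 j) := by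
  unfold SPerfOf; simp only [hS1]

/-- [our object] `m = 1` with the wall family's tables: `WPerfOf … 1` is road A2's `Winf`. -/
theorem WPerfOf_one (sf sm : ℕ → ℝ)
    {Wt : ℕ → ℕ → Fin (d + 1) → (Fin (d + 1) → ℤ) → Fin (d + 1) → (Fin (d + 1) → ℤ) → MKer (d + 1) (Fib d)}
    {W : ℕ → Fin (d + 1) → (Fin (d + 1) → ℤ) → Fin (d + 1) → (Fin (d + 1) → ℤ) → MKer (d + 1) (Fib d)}
    (hW1 : ∀ j, Wt j 1 = W j) : WPerfOf sf sm Wt 1 = limTabOf fun j => unitW (sf j) (sm j) (W j) := by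
  unfold WPerfOf; simp only [hW1]

end Objects

/-- [our object] **THE ONE-LOOP POLARIZATION KERNEL OF ONE STEP WITH BLOCKING `n`** over a packed resolvent `K`, first-order jets `S` and tables `W`
(dimension four): `hessKer (axDressK n K) (axVertexOfK K n S) W` — the shape of the wall's family member (`TbalOf_JsBalOf`) and of road A2's `T∞`. -/
noncomputable def TPerfOf (n : ℕ) (K : MKer (3 + 1) (Fib 3)) (S : Fin (3 + 1) → (Fin (3 + 1) → ℤ) → MKer (3 + 1) (Fib 3))
    (W : Fin (3 + 1) → (Fin (3 + 1) → ℤ) → Fin (3 + 1) → (Fin (3 + 1) → ℤ) → MKer (3 + 1) (Fib 3)) :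
    Fin (3 + 1) → Fin (3 + 1) → (Fin (3 + 1) → ℤ) → ℝ :=
  hessKer (axDressK n K) (axVertexOfK K n S) W

section Coefficient

variable (Lc : ℕ) [NeZero Lc] (sf sm : ℕ → ℝ)
  (S : ℕ → ℕ → Fin (3 + 1) → (Fin (3 + 1) → ℤ) → MKer (3 + 1) (Fib 3))
  (Wt : ℕ → ℕ → Fin (3 + 1) → (Fin (3 + 1) → ℤ) → Fin (3 + 1) → (Fin (3 + 1) → ℤ) → MKer (3 + 1) (Fib 3))
  (μ ν : Fin 4)

/-- [our object] **THE PERFECT COEFFICIENT FAMILY** `m ↦ fPerf … m` = the (1.22) second moment, channel `(μ, ν)`, of the one-loop polarization of the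
perfect `m`-fold step (blocking `Lc^m`; by leaf N1 = ONE perfect step with blocking `Lc^m`). -/
noncomputable def fPerf (m : ℕ) : ℝ :=
  B12Beta.secondMoment (TPerfOf (Lc ^ m) (KPerf Lc sf sm m) (SPerfOf sf sm S m) (WPerfOf sf sm Wt m)) μ ν

/-- [our object] Unfolding of `fPerf`. -/
theorem fPerf_def (m : ℕ) : fPerf Lc sf sm S Wt μ ν m =
    B12Beta.secondMoment (hessKer (axDressK (Lc ^ m) (KPerf Lc sf sm m)) (axVertexOfK (KPerf Lc sf sm m) (Lc ^ m) (SPerfOf sf sm S m))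
      (WPerfOf sf sm Wt m)) μ ν := rfl

/-- [our object] **`m = 1` IS ROAD A2's LIMIT VALUE**: `fPerf … 1 = secondMoment (hessKer (axDressK Lc K∞) (axVertexOfK K∞ Lc S∞) W∞) μ ν` at road A2's
constructed limit triple of the wall family (`hS1`, `hW1` name the `m = 1` members). -/
theorem fPerf_one {hLc : 1 ≤ Lc} {cE cVH cΛ : ℝ}
    {W : ℕ → Fin (3 + 1) → (Fin (3 + 1) → ℤ) → Fin (3 + 1) → (Fin (3 + 1) → ℤ) → MKer (3 + 1) (Fib 3)}
    {Cw' δw : ℕ → ℝ} {hδw : ∀ j, 0 < δw j} {hW' : ∀ j, VertexFamily₂ (W j) Lc (Cw' j) (δw j)}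
    (hS1 : ∀ j, S j 1 = (JsBal0Of hLc cE cVH cΛ W Cw' δw hδw hW' j).S) (hW1 : ∀ j, Wt j 1 = W j) :
    fPerf Lc sf sm S Wt μ ν 1 =
      B12Beta.secondMoment (hessKer (axDressK Lc (limMKerOf fun j => unitK (sf j) (sm j) (KInvStep (d := 3) Lc j)))
        (axVertexOfK (limMKerOf fun j => unitK (sf j) (sm j) (KInvStep (d := 3) Lc j)) Lc
          (limStOf fun j => unitS (sf j) (sm j) (JsBal0Of hLc cE cVH cΛ W Cw' δw hδw hW' j).S))
        (limTabOf fun j => unitW (sf j) (sm j) (W j))) μ ν := by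
  rw [fPerf_def, pow_one, KPerf_one (d := 3) Lc sf sm, SPerfOf_one sf sm hS1, WPerfOf_one sf sm hW1]

end Coefficient

/-! ## §2 ROAD FP's END OVER THE PERFECT FAMILY -/

section End

variable {Lc : ℕ} [NeZero Lc] (hLc : 1 ≤ Lc) (cE cVH cΛ : ℝ)
  (W : ℕ → Fin (3 + 1) → (Fin (3 + 1) → ℤ) → Fin (3 + 1) → (Fin (3 + 1) → ℤ) → MKer (3 + 1) (Fib 3))
  (Cw' δw : ℕ → ℝ) (hδw : ∀ j, 0 < δw j) (hW' : ∀ j, VertexFamily₂ (W j) Lc (Cw' j) (δw j))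
  (sf sm : ℕ → ℝ)
  (S : ℕ → ℕ → Fin (3 + 1) → (Fin (3 + 1) → ℤ) → MKer (3 + 1) (Fib 3))
  (Wt : ℕ → ℕ → Fin (3 + 1) → (Fin (3 + 1) → ℤ) → Fin (3 + 1) → (Fin (3 + 1) → ℤ) → MKer (3 + 1) (Fib 3))
  {R C cK δK Cs cS δS Cw cW δW θ : ℝ}

/-- **ROAD «FP», THE END OVER THE PERFECT FAMILY (bounded-defect form).**  (CONV-C-Cauchy) in limit currency AT THE PERFECT TRIPLE
`(KPerf … 1, SPerfOf … 1, WPerfOf … 1)` (row G-an2-4 — HYPOTHESES) + the STEP LAW of the perfect coefficient family (leaf N2/N6) + its LEADING-LOG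
ASYMPTOTICS with bounded defect (leaf N7) ⊢ the wall literal `D1Drift Lc (JsBalOf …) N μ ν`.  Discharges nothing by itself. -/
theorem d1Drift_JsBalOf_of_perfect_step_law_bounded (hsf : ∀ j, sf j ≠ 0) (hsm : ∀ j, sm j ≠ 0)
    (hS1 : ∀ j, S j 1 = (JsBal0Of hLc cE cVH cΛ W Cw' δw hδw hW' j).S) (hW1 : ∀ j, Wt j 1 = W j)
    (hK : ∀ j, Decays (unitK (sf j) (sm j) (KInvStep (d := 3) Lc j)) C δK) (hKinf : Decays (KPerf (d := 3) Lc sf sm 1) C δK)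
    (hKrate : ∀ j, Decays (unitK (sf j) (sm j) (KInvStep (d := 3) Lc j) - KPerf (d := 3) Lc sf sm 1) (cK * θ ^ j) δK)
    (hS : ∀ j, LocStencil (unitS (sf j) (sm j) (JsBal0Of hLc cE cVH cΛ W Cw' δw hδw hW' j).S) Cs δS) (hSinf : LocStencil (SPerfOf sf sm S 1) Cs δS)
    (hSrate : ∀ j, LocStencil (unitS (sf j) (sm j) (JsBal0Of hLc cE cVH cΛ W Cw' δw hδw hW' j).S - SPerfOf sf sm S 1) (cS * θ ^ j) δS)
    (hW : ∀ j, VertexFamily₂ (unitW (sf j) (sm j) (W j)) Lc Cw δW) (hWinf : VertexFamily₂ (WPerfOf sf sm Wt 1) Lc Cw δW)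
    (hWrate : ∀ j, VertexFamily₂ (unitW (sf j) (sm j) (W j) - WPerfOf sf sm Wt 1) Lc (cW * θ ^ j) δW)
    (hR : 0 < R) (hRK : R < δK) (hRS : R / 2 < δS) (hRW : R < δW) (hθ0 : 0 ≤ θ) (hθ1 : θ < 1) (μ ν : Fin 4) {N Cg : ℝ}
    (hstep : ∀ m : ℕ, 1 ≤ m → fPerf Lc sf sm S Wt μ ν (m + 1) = fPerf Lc sf sm S Wt μ ν m + fPerf Lc sf sm S Wt μ ν 1)
    (hasym : ∀ m : ℕ, 1 ≤ m → |fPerf Lc sf sm S Wt μ ν m - (m : ℝ) * stepBal N Lc| ≤ Cg) :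
    D1Drift Lc (JsBalOf hLc cE cVH cΛ W Cw' δw hδw hW') N μ ν := by
  have h1 := fPerf_one Lc sf sm S Wt μ ν hS1 hW1
  rw [← KPerf_one (d := 3) Lc sf sm, ← SPerfOf_one sf sm hS1, ← WPerfOf_one sf sm hW1] at h1
  exact d1Drift_JsBalOf_of_rate_step_law_bounded hLc cE cVH cΛ W Cw' δw hδw hW' sf sm hsf hsm hK hKinf hKrate hS hSinf hSrate hW hWinf hWrate
    hR hRK hRS hRW hθ0 hθ1 μ ν h1 hstep hasym

/-- **ROAD «FP», THE END OVER THE PERFECT FAMILY (mean-law form)**: the asymptotic input weakened to `(fPerf m − m·stepBal N Lc)/m → 0`. -/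
theorem d1Drift_JsBalOf_of_perfect_step_law_littleO (hsf : ∀ j, sf j ≠ 0) (hsm : ∀ j, sm j ≠ 0)
    (hS1 : ∀ j, S j 1 = (JsBal0Of hLc cE cVH cΛ W Cw' δw hδw hW' j).S) (hW1 : ∀ j, Wt j 1 = W j)
    (hK : ∀ j, Decays (unitK (sf j) (sm j) (KInvStep (d := 3) Lc j)) C δK) (hKinf : Decays (KPerf (d := 3) Lc sf sm 1) C δK)
    (hKrate : ∀ j, Decays (unitK (sf j) (sm j) (KInvStep (d := 3) Lc j) - KPerf (d := 3) Lc sf sm 1) (cK * θ ^ j) δK)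
    (hS : ∀ j, LocStencil (unitS (sf j) (sm j) (JsBal0Of hLc cE cVH cΛ W Cw' δw hδw hW' j).S) Cs δS) (hSinf : LocStencil (SPerfOf sf sm S 1) Cs δS)
    (hSrate : ∀ j, LocStencil (unitS (sf j) (sm j) (JsBal0Of hLc cE cVH cΛ W Cw' δw hδw hW' j).S - SPerfOf sf sm S 1) (cS * θ ^ j) δS)
    (hW : ∀ j, VertexFamily₂ (unitW (sf j) (sm j) (W j)) Lc Cw δW) (hWinf : VertexFamily₂ (WPerfOf sf sm Wt 1) Lc Cw δW)
    (hWrate : ∀ j, VertexFamily₂ (unitW (sf j) (sm j) (W j) - WPerfOf sf sm Wt 1) Lc (cW * θ ^ j) δW)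
    (hR : 0 < R) (hRK : R < δK) (hRS : R / 2 < δS) (hRW : R < δW) (hθ0 : 0 ≤ θ) (hθ1 : θ < 1) (μ ν : Fin 4) {N : ℝ}
    (hstep : ∀ m : ℕ, 1 ≤ m → fPerf Lc sf sm S Wt μ ν (m + 1) = fPerf Lc sf sm S Wt μ ν m + fPerf Lc sf sm S Wt μ ν 1)
    (hasym : Tendsto (fun m : ℕ => (fPerf Lc sf sm S Wt μ ν m - (m : ℝ) * stepBal N Lc) / (m : ℝ)) atTop (𝓝 0)) :
    D1Drift Lc (JsBalOf hLc cE cVH cΛ W Cw' δw hδw hW') N μ ν := by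
  have h1 := fPerf_one Lc sf sm S Wt μ ν hS1 hW1
  rw [← KPerf_one (d := 3) Lc sf sm, ← SPerfOf_one sf sm hS1, ← WPerfOf_one sf sm hW1] at h1
  exact d1Drift_JsBalOf_of_rate_step_law_littleO hLc cE cVH cΛ W Cw' δw hδw hW' sf sm hsf hsm hK hKinf hKrate hS hSinf hSrate hW hWinf hWrate
    hR hRK hRS hRW hθ0 hθ1 μ ν h1 hstep hasym

end End

end Summit.QuantumFields.BalabanUV.Beta.FP.PerfectObjectsT
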